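import Summits.Ventures.QEC.Census.CertChunks
import Summits.Ventures.QEC.Census.BB.BB72.Cert
import HarnessLib

/-!
# `BB72` — KERNEL-tier lower-bound replay, side Z, leaf file 7/10 (emitted by qec-search-7)

Bruteforce replay (CERT-FORMAT v1 §5.1, lemma L3) of the certificate `7e943c5a566adc43`: every Z-type operator of weight
`1 … 5` has nonzero syndrome (rows `cert.HX`) or is allow-listed (allow-list []). This file holds
10 packed chunk evaluations (`chunk1R`/`chunk2R` of `Census/CertChunks.lean` over `posList 72 cert.HX`), total
1555719 scan end points, each closed by `decide +kernel` — tier KERNEL (CERTIFIED): axioms ⊆ {propext, Classical.choice,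
Quot.sound}. Assembled in `BB/BB72/KernelZ.lean`. Do not edit; re-emit (HOME/census/search-7/emit_kernel.py).
-/

namespace Summit.Ventures.QEC.Census.BB72

/-- Level-2 chunks `(12, j)`, `0 ≤ j < 7`, side Z of `BB72` (195202 end points): pass. -/
theorem kZ2_12_0 : chunk2R (leafTest []) (posList 72 cert.HX) 3 12 0 7 = true := by decide +kernel

/-- Level-2 chunks `(12, j)`, `7 ≤ j < 19`, side Z of `BB72` (192113 end points): pass. -/
theorem kZ2_12_7 : chunk2R (leafTest []) (posList 72 cert.HX) 3 12 7 12 = true := by decide +kernel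

/-- Level-2 chunks `(12, j)`, `19 ≤ j < 59`, side Z of `BB72` (102090 end points): pass. -/
theorem kZ2_12_19 : chunk2R (leafTest []) (posList 72 cert.HX) 3 12 19 40 = true := by decide +kernel

/-- Level-2 chunks `(13, j)`, `0 ≤ j < 7`, side Z of `BB72` (184786 end points): pass. -/
theorem kZ2_13_0 : chunk2R (leafTest []) (posList 72 cert.HX) 3 13 0 7 = true := by decide +kernel

/-- Level-2 chunks `(13, j)`, `7 ≤ j < 21`, side Z of `BB72` (197533 end points): pass. -/
theorem kZ2_13_7 : chunk2R (leafTest []) (posList 72 cert.HX) 3 13 7 14 = true := by decide +kernel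

/-- Level-2 chunks `(13, j)`, `21 ≤ j < 58`, side Z of `BB72` (74518 end points): pass. -/
theorem kZ2_13_21 : chunk2R (leafTest []) (posList 72 cert.HX) 3 13 21 37 = true := by decide +kernel

/-- Level-2 chunks `(14, j)`, `0 ≤ j < 8`, side Z of `BB72` (194398 end points): pass. -/
theorem kZ2_14_0 : chunk2R (leafTest []) (posList 72 cert.HX) 3 14 0 8 = true := by decide +kernel

/-- Level-2 chunks `(14, j)`, `8 ≤ j < 27`, side Z of `BB72` (199595 end points): pass. -/
theorem kZ2_14_8 : chunk2R (leafTest []) (posList 72 cert.HX) 3 14 8 19 = true := by decide +kernel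

/-- Level-2 chunks `(14, j)`, `27 ≤ j < 57`, side Z of `BB72` (31930 end points): pass. -/
theorem kZ2_14_27 : chunk2R (leafTest []) (posList 72 cert.HX) 3 14 27 30 = true := by decide +kernel

/-- Level-2 chunks `(15, j)`, `0 ≤ j < 8`, side Z of `BB72` (183554 end points): pass. -/
theorem kZ2_15_0 : chunk2R (leafTest []) (posList 72 cert.HX) 3 15 0 8 = true := by decide +kernel

end Summit.Ventures.QEC.Census.BB72
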